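import Mathlib.Analysis.Calculus.FDeriv.Mul
import Mathlib.Analysis.Calculus.ContDiff.Operations
import Mathlib.Analysis.Normed.Ring.Units
import HarnessLib

/-!
# The Cayley transform `c(X) = (1 − X)(1 + X)⁻¹` in a real (Banach) algebra: an involution on `{X | 1 + X invertible}`,
# `1 + c(X) = 2(1+X)⁻¹`, `1 − c(X) = 2X(1+X)⁻¹`, and its derivative `Dc(X) H = −2 (1+X)⁻¹ H (1+X)⁻¹`
(Weyl, *The Classical Groups* (1939), Ch. II §10 «Cayley's rational parametrization»; Knapp, *Lie Groups Beyond an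
Introduction* (2002), Introduction §2.)

Topic `Analysis/Calculus`; namespace `Literature.Analysis.Calculus`.  One definition with body (`cayley`) and proved theorems:
no named fact, no instance, no notation, no `sorry`.  Cell `hodgecm-mathlib`, F0∕P3 road «DM∞» (archimedean Dixmier–Malliavin,
weak form, for `U(H)(L⁺ ⊗ ℝ)`; census `F0/P3/p03/CENSUS-DMinf.F0P3p03g8.md`), brick B5a, generic part: the companions
`NumberTheory/Automorphic/UnitaryGroupArchSkew` (the `J`-skew-hermitian matrices and `c(𝔲) ⊆ U(J)`) and
`…/UnitaryGroupArchCayleyChart` (the chart `ĉ : 𝔲 → U(J)(E ⊗ ℝ)`) specialise it to `M_N(E ⊗ ℝ)`.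

CONTENT (`R` a ring; from §1b on a real algebra, so that `2` is a unit; in §2 a real Banach algebra with summable geometric
series, Mathlib's setting for `hasFDerivAt_ringInverse`).
* §1 `cayley X = (1 − X) * Ring.inverse (1 + X)` (total; junk off the units), `cayley_zero : c 0 = 1`, commuting lemmas,
  `cayley_eq_inverse_mul`, **`one_add_cayley : 1 + c X = 2 (1+X)⁻¹`**, **`one_sub_cayley : 1 − c X = 2 X (1+X)⁻¹`**,
  `isUnit_cayley_iff : IsUnit (c X) ↔ IsUnit (1 − X)`;
* §1b `isUnit_two`, `two_mul_eq_zero_iff`, `isUnit_one_add_cayley`, **`cayley_cayley : c (c X) = X`** (for `1 + X` a unit),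
  `isUnit_one_sub_cayley_iff : IsUnit (1 − c X) ↔ IsUnit X`;
* §2 **`hasFDerivAt_cayley`** (`Dc(X) = −2 • mulLeftRight ℝ R u⁻¹ u⁻¹`, `u = 1 + X`; product rule `HasFDerivAt.mul'` and
  `hasFDerivAt_ringInverse`), `hasFDerivAt_cayley_zero` (`Dc(0) = −2 · id`), `contDiffAt_cayley`, `contDiffOn_cayley` on
  `{X | IsUnit (1 + X)}`, `continuousOn_cayley`, `continuousAt_cayley`, `isOpen_setOf_isUnit_one_add∕sub`.

HONEST SCOPE.  Elementary; Mathlib only.  HC_CM is proved only modulo the printed citations until rung 0 closes; this file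
discharges no printed statement (banked currency for the road's B5b∕B6).

## References
* H. Weyl, *The Classical Groups, their Invariants and Representations*, Princeton (1939), Ch. II §10. [Weyl1939]
* A. W. Knapp, *Lie Groups Beyond an Introduction*, 2nd ed., Birkhäuser (2002), Introduction §2 (closed linear groups, `exp`,
  rational maps of matrices). [Knapp2002]
-/

set_option autoImplicit false

noncomputable section

open Set Filter Topology
open scoped ContDiff

namespace Literature.Analysis.Calculus

/-! ## §1 The Cayley transform in a ring -/

section Ring

variable {R : Type*} [Ring R]

/-- **The Cayley transform** `c(X) = (1 − X)(1 + X)⁻¹`. [cite: Weyl1939, Ch. II §10] -/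
def cayley (X : R) : R := (1 - X) * Ring.inverse (1 + X)

/-- Unfolding of `cayley`. [cite: Weyl1939, Ch. II §10] -/
theorem cayley_def (X : R) : cayley X = (1 - X) * Ring.inverse (1 + X) := rfl

/-- `c(0) = 1`. [cite: Weyl1939, Ch. II §10] -/
@[simp] theorem cayley_zero : cayley (0 : R) = 1 := by
  rw [cayley_def, sub_zero, add_zero, Ring.inverse_one, mul_one]

/-- `1 − X` commutes with `1 + X`. [folklore] -/
private theorem commute_one_sub_one_add (X : R) : Commute (1 - X) (1 + X) :=
  (Commute.one_left (1 + X)).sub_left ((Commute.one_right X).add_right (Commute.refl X))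

variable {X : R}

/-- `(1+X)⁻¹` is the inverse of the unit `1 + X`. [folklore] -/
private theorem inverse_one_add_eq (h : IsUnit (1 + X)) : Ring.inverse (1 + X) = ((h.unit⁻¹ : Rˣ) : R) :=
  Ring.inverse_of_isUnit h

/-- `1 − X` commutes with `(1 + X)⁻¹`. [folklore] -/
private theorem commute_one_sub_inverse_one_add (h : IsUnit (1 + X)) : Commute (1 - X) (Ring.inverse (1 + X)) := by
  rw [inverse_one_add_eq h]
  refine Commute.units_inv_right ?_
  rw [h.unit_spec]
  exact commute_one_sub_one_add X

/-- `X` commutes with `(1 + X)⁻¹`. [folklore] -/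
private theorem commute_self_inverse_one_add (h : IsUnit (1 + X)) : Commute X (Ring.inverse (1 + X)) := by
  rw [inverse_one_add_eq h]
  refine Commute.units_inv_right ?_
  rw [h.unit_spec]
  exact (Commute.one_right X).add_right (Commute.refl X)

/-- `c(X) = (1+X)⁻¹ (1 − X)` as well. [cite: Weyl1939, Ch. II §10] -/
theorem cayley_eq_inverse_mul (h : IsUnit (1 + X)) : cayley X = Ring.inverse (1 + X) * (1 - X) := by
  rw [cayley_def, (commute_one_sub_inverse_one_add h).eq]

/-- **`1 + c(X) = 2 (1+X)⁻¹`.** [cite: Weyl1939, Ch. II §10] -/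
theorem one_add_cayley (h : IsUnit (1 + X)) : 1 + cayley X = 2 * Ring.inverse (1 + X) := by
  have h1 : (1 + X) * Ring.inverse (1 + X) = 1 := Ring.mul_inverse_cancel _ h
  calc 1 + cayley X = (1 + X) * Ring.inverse (1 + X) + (1 - X) * Ring.inverse (1 + X) := by rw [h1, cayley_def]
    _ = ((1 + X) + (1 - X)) * Ring.inverse (1 + X) := (add_mul _ _ _).symm
    _ = 2 * Ring.inverse (1 + X) := by rw [add_add_sub_cancel, one_add_one_eq_two]

/-- **`1 − c(X) = 2 X (1+X)⁻¹`.** [cite: Weyl1939, Ch. II §10] -/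
theorem one_sub_cayley (h : IsUnit (1 + X)) : 1 - cayley X = 2 * X * Ring.inverse (1 + X) := by
  have h1 : (1 + X) * Ring.inverse (1 + X) = 1 := Ring.mul_inverse_cancel _ h
  have h2 : (1 + X) - (1 - X) = 2 * X := by rw [two_mul]; abel
  calc 1 - cayley X = (1 + X) * Ring.inverse (1 + X) - (1 - X) * Ring.inverse (1 + X) := by rw [h1, cayley_def]
    _ = ((1 + X) - (1 - X)) * Ring.inverse (1 + X) := (sub_mul _ _ _).symm
    _ = 2 * X * Ring.inverse (1 + X) := by rw [h2]

/-- `c(X)` is a unit iff `1 − X` is (for `1 + X` a unit). [cite: Weyl1939, Ch. II §10] -/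
theorem isUnit_cayley_iff (h : IsUnit (1 + X)) : IsUnit (cayley X) ↔ IsUnit (1 - X) := by
  rw [cayley_def, inverse_one_add_eq h, Units.isUnit_mul_units]

/-- `c(X)` is a unit when `1 ± X` are. [cite: Weyl1939, Ch. II §10] -/
theorem isUnit_cayley (h : IsUnit (1 + X)) (h' : IsUnit (1 - X)) : IsUnit (cayley X) := (isUnit_cayley_iff h).2 h'

end Ring

/-! ## §1b The Cayley transform in a real algebra: `2` is invertible -/

section Algebra

variable {R : Type*} [Ring R] [Algebra ℝ R]

/-- `2` is a unit of a real algebra (the standing hypothesis «characteristic `≠ 2`» of Cayley's parametrization). [cite: Weyl1939, Ch. II §10] -/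
theorem isUnit_two : IsUnit (2 : R) := by
  have h : (algebraMap ℝ R) 2 = 2 := map_ofNat _ 2
  rw [← h]
  exact (IsUnit.mk0 (2 : ℝ) two_ne_zero).map (algebraMap ℝ R)

omit [Algebra ℝ R] in
/-- `2` is central. [folklore] -/
private theorem two_commute (a : R) : Commute (2 : R) a := by
  rw [← one_add_one_eq_two]
  exact (Commute.one_left a).add_left (Commute.one_left a)

/-- In a real algebra, `2 a = 0 ↔ a = 0` (characteristic `≠ 2`). [cite: Weyl1939, Ch. II §10] -/
theorem two_mul_eq_zero_iff (a : R) : 2 * a = 0 ↔ a = 0 := by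
  refine ⟨fun h => ?_, fun h => by rw [h, mul_zero]⟩
  have h2 : Ring.inverse (2 : R) * (2 * a) = 0 := by rw [h, mul_zero]
  rwa [← mul_assoc, Ring.inverse_mul_cancel (2 : R) isUnit_two, one_mul] at h2

variable {X : R}

/-- `1 + c(X)` is a unit (it is `2(1+X)⁻¹`). [cite: Weyl1939, Ch. II §10] -/
theorem isUnit_one_add_cayley (h : IsUnit (1 + X)) : IsUnit (1 + cayley X) := by
  rw [one_add_cayley h]
  exact isUnit_two.mul h.ringInverse

/-- **THE CAYLEY TRANSFORM IS AN INVOLUTION**: `c(c(X)) = X` whenever `1 + X` is invertible. [cite: Weyl1939, Ch. II §10] -/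
theorem cayley_cayley (h : IsUnit (1 + X)) : cayley (cayley X) = X := by
  obtain ⟨t, ht⟩ := (isUnit_two : IsUnit (2 : R))
  set u := h.unit with hu_def
  have hu : (u : R) = 1 + X := h.unit_spec
  have hinv : Ring.inverse (1 + X) = ((u⁻¹ : Rˣ) : R) := inverse_one_add_eq h
  have htX : Commute (t : R) X := by rw [ht]; exact two_commute X
  rw [cayley_def, one_sub_cayley h, one_add_cayley h, hinv, ← ht, ← Units.val_mul, Ring.inverse_unit, mul_inv_rev, inv_inv,
    Units.val_mul]
  calc (t : R) * X * ((u⁻¹ : Rˣ) : R) * ((u : R) * ((t⁻¹ : Rˣ) : R))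
      = (t : R) * X * (((u⁻¹ : Rˣ) : R) * (u : R)) * ((t⁻¹ : Rˣ) : R) := by simp only [mul_assoc]
    _ = X * (t : R) * ((t⁻¹ : Rˣ) : R) := by rw [Units.inv_mul, mul_one, htX.eq]
    _ = X := Units.mul_inv_cancel_right X t

/-- `1 − c(X)` is a unit iff `X` is (for `1 + X` a unit). [cite: Weyl1939, Ch. II §10] -/
theorem isUnit_one_sub_cayley_iff (h : IsUnit (1 + X)) : IsUnit (1 - cayley X) ↔ IsUnit X := by
  obtain ⟨t, ht⟩ := (isUnit_two : IsUnit (2 : R))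
  rw [one_sub_cayley h, inverse_one_add_eq h, Units.isUnit_mul_units, ← ht, Units.isUnit_units_mul]

end Algebra

/-! ## §2 Calculus of the Cayley transform in a real Banach algebra -/

section Calculus

variable {R : Type*} [NormedRing R] [NormedAlgebra ℝ R] [HasSummableGeomSeries R]

omit [NormedAlgebra ℝ R] [HasSummableGeomSeries R] in
/-- `cayley` as a pointwise product of functions. [folklore] -/
private theorem cayley_eq_mul : (cayley : R → R) = (fun Y : R => 1 - Y) * fun Y : R => Ring.inverse (1 + Y) := rfl

variable {X : R}

/-- **THE DERIVATIVE OF THE CAYLEY TRANSFORM**: at `X` with `u = 1 + X` invertible, `Dc(X) H = −2 u⁻¹ H u⁻¹`.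
[cite: Knapp2002, Introduction §2] -/
theorem hasFDerivAt_cayley (h : IsUnit (1 + X)) :
    HasFDerivAt (cayley : R → R)
      (-(2 : ℝ) • ContinuousLinearMap.mulLeftRight ℝ R ((h.unit⁻¹ : Rˣ) : R) ((h.unit⁻¹ : Rˣ) : R)) X := by
  set u := h.unit with hu_def
  have hu : (u : R) = 1 + X := h.unit_spec
  have hinv : Ring.inverse (1 + X) = ((u⁻¹ : Rˣ) : R) := inverse_one_add_eq h
  have ha : HasFDerivAt (fun Y : R => 1 - Y) (-(ContinuousLinearMap.id ℝ R)) X := (hasFDerivAt_id X).const_sub 1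
  have hb : HasFDerivAt (fun Y : R => Ring.inverse (1 + Y))
      (-(ContinuousLinearMap.mulLeftRight ℝ R ((u⁻¹ : Rˣ) : R) ((u⁻¹ : Rˣ) : R))) X := by
    have h1 : HasFDerivAt (fun Y : R => 1 + Y) (ContinuousLinearMap.id ℝ R) X := (hasFDerivAt_id X).const_add 1
    have h2 : HasFDerivAt Ring.inverse (-(ContinuousLinearMap.mulLeftRight ℝ R ((u⁻¹ : Rˣ) : R) ((u⁻¹ : Rˣ) : R))) (1 + X) := by
      rw [← hu]; exact hasFDerivAt_ringInverse u
    have h3 := h2.comp X h1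
    rwa [ContinuousLinearMap.comp_id] at h3
  have hm := ha.mul' hb
  rw [← cayley_eq_mul] at hm
  refine hm.congr_fderiv ?_
  ext H
  simp only [add_apply, FunLike.coe_smul, Pi.smul_apply, neg_apply,
    ContinuousLinearMap.mulLeftRight_apply, ContinuousLinearMap.id_apply, smul_eq_mul, MulOpposite.smul_eq_mul_unop,
    MulOpposite.unop_op, smul_neg]
  -- `-((1 - X) (u⁻¹ H u⁻¹)) + -(H (1+X)⁻¹) = (-2) • (u⁻¹ H u⁻¹)`
  rw [hinv]
  have hkey : (1 - X) * ((u⁻¹ : Rˣ) : R) + 1 = 2 * ((u⁻¹ : Rˣ) : R) := by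
    have e := one_add_cayley h
    rw [cayley_def, hinv, add_comm] at e
    exact e
  calc -((1 - X) * (((u⁻¹ : Rˣ) : R) * H * ((u⁻¹ : Rˣ) : R))) + -(H * ((u⁻¹ : Rˣ) : R))
      = -(((1 - X) * ((u⁻¹ : Rˣ) : R) + 1) * (H * ((u⁻¹ : Rˣ) : R))) := by
        rw [add_mul, one_mul, neg_add]; simp only [mul_assoc]
    _ = -((2 : ℝ) • (((u⁻¹ : Rˣ) : R) * H * ((u⁻¹ : Rˣ) : R))) := by
        rw [hkey, ofNat_smul_eq_nsmul ℝ 2, two_nsmul, two_mul, add_mul]; simp only [mul_assoc]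
    _ = (-(2 : ℝ)) • (((u⁻¹ : Rˣ) : R) * H * ((u⁻¹ : Rˣ) : R)) := (neg_smul _ _).symm

/-- The derivative of the Cayley transform at `0` is `−2 · id`. [cite: Knapp2002, Introduction §2] -/
theorem hasFDerivAt_cayley_zero : HasFDerivAt (cayley : R → R) (-(2 : ℝ) • ContinuousLinearMap.id ℝ R) 0 := by
  have h : IsUnit (1 + (0 : R)) := by rw [add_zero]; exact isUnit_one
  have h1 : ((h.unit⁻¹ : Rˣ) : R) = 1 := by
    have e : h.unit = 1 := Units.ext (by rw [h.unit_spec, add_zero, Units.val_one])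
    rw [e, inv_one, Units.val_one]
  have := hasFDerivAt_cayley h
  rw [h1] at this
  refine this.congr_fderiv ?_
  ext H
  simp only [FunLike.coe_smul, Pi.smul_apply, ContinuousLinearMap.mulLeftRight_apply, one_mul, mul_one,
    ContinuousLinearMap.id_apply]

/-- The Cayley transform is smooth at every `X` with `1 + X` invertible. [cite: Knapp2002, Introduction §2] -/
theorem contDiffAt_cayley {n : WithTop ℕ∞} (h : IsUnit (1 + X)) : ContDiffAt ℝ n (cayley : R → R) X := by
  rw [cayley_eq_mul]
  refine (contDiffAt_const.sub contDiffAt_id).mul ?_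
  have h2 : ContDiffAt ℝ n Ring.inverse (1 + X) := by
    rw [← h.unit_spec]; exact contDiffAt_ringInverse ℝ h.unit
  exact h2.comp X (contDiffAt_const.add contDiffAt_id)

/-- The Cayley transform is smooth on `{X | IsUnit (1 + X)}`. [cite: Knapp2002, Introduction §2] -/
theorem contDiffOn_cayley {n : WithTop ℕ∞} : ContDiffOn ℝ n (cayley : R → R) {X | IsUnit (1 + X)} :=
  fun _ hX => (contDiffAt_cayley hX).contDiffWithinAt

/-- The Cayley transform is continuous on `{X | IsUnit (1 + X)}`. [cite: Weyl1939, Ch. II §10] -/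
theorem continuousOn_cayley : ContinuousOn (cayley : R → R) {X | IsUnit (1 + X)} :=
  (contDiffOn_cayley (n := 0)).continuousOn

/-- The Cayley transform is continuous at every `X` with `1 + X` invertible. [cite: Weyl1939, Ch. II §10] -/
theorem continuousAt_cayley (h : IsUnit (1 + X)) : ContinuousAt (cayley : R → R) X :=
  (contDiffAt_cayley (n := 0) h).continuousAt

omit [NormedAlgebra ℝ R] in
/-- `{X | IsUnit (1 + X)}` is open (the units of a Banach algebra are open). [cite: Knapp2002, Introduction §2] -/
theorem isOpen_setOf_isUnit_one_add : IsOpen {X : R | IsUnit (1 + X)} :=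
  Units.isOpen.preimage (continuous_const.add continuous_id)

omit [NormedAlgebra ℝ R] in
/-- `{X | IsUnit (1 − X)}` is open (the units of a Banach algebra are open). [cite: Knapp2002, Introduction §2] -/
theorem isOpen_setOf_isUnit_one_sub : IsOpen {X : R | IsUnit (1 - X)} :=
  Units.isOpen.preimage (continuous_const.sub continuous_id)

end Calculus

end Literature.Analysis.Calculus
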